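import Summits.Ventures.YMGap.RobustBall.RobustAreaLawVertexW
import HarnessLib

/-!
# Robust ball (Y2), area-law side — the CERTIFIED FRONTIER `ε(β_W)` of the TIER-2 ball (`κ = log 6/5`), `SU(2)`, `d = 4`, affine-vertex door

HONEST FRAMING: venture file of the cell `pub-ymgap` (QuantumFields programme), track ROBUST-BALL, seat rb-p2 (g2).  Strong-coupling LATTICE
statements on finite tori, uniform in the size; nothing about the continuum, a mass gap, or Clay.

WHAT.  The tier-2 twin of `AreaLawFrontierSU2`: ds-4's affine-vertex tier-2 door `su2_areaLawOnBallW_vertex_of_row` (diameter-weighted ball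
`ClusterDomain (log 6/5) (2ε) ε ∩ IsSlabLocal mv`, NO range cut-off; weighted row condition `rhoFR 2 ((6/5)^{1/3}·3β_W/2) (2ε) ε < 1`) certified at
twelve couplings with ds-4's majorants `(6/5)^{1/3} ≤ 1.0627`, `e^{2ε} ≤ T₄(2ε)`, `√2 ≤ 1.41422` (`rhoFR_two_lt_one_of_bounds`):
`(β_W, ε) = (1/10, .436), (1/8, .395), (1/6, .331), (1/5, .279), (1/4, .218), (3/10, .171), (1/3, .144), (2/5, .100), (9/20, .072), (1/2, .048),
(11/20, .027), (3/5, .009)` — `AreaLawOnBallW 2 4 (β_W/2) (log(6/5)) (2ε) ε mv` for every window `mv ≥ 1` — each `ε` the largest multiple of `1/1000`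
the majorised door admits (door float optimum per row, `< 0.0015` above).  ds-4's rows of record at `1/8`, `1/3`, `1/2` (`.39`, `.14`, `.045`) are the
cells these refine.  Exact rational arithmetic (`norm_num`); second lineage: rb-theory's screen.
WHAT THIS IS NOT.  The frontier is the DOOR's, not the phase's; nothing is claimed at or beyond the tier-2 door's threshold `(6/5)^{1/3}·3β_W/2 = 1`,
i.e. `β_W ≈ 0.627`.
-/

noncomputable section

open MeasureTheory Real
open Literature.MathematicalPhysics.QuantumLattice (fundamentalRep)
open Literature.MathematicalPhysics.QuantumFieldTheory

namespace Summit.Ventures.YMGap.RobustBall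

/-- Tier-2 frontier cell `(β_W, κ, ε) = (1/10, log 6/5, 0.436)` [door optimum `.4370`]:
`AreaLawOnBallW 2 4 (1 / 20) (log(6/5)) (109 / 125) (109 / 250) mv`. [folklore] -/
theorem su2_frontierW_1_10 {mv : ℕ} (hmv : 1 ≤ mv) :
    AreaLawOnBallW 2 4 (1 / 20) (Real.log (6 / 5)) (109 / 125) (109 / 250) mv := by
  rw [show (1 / 20 : ℝ) = 1 / 10 / 2 by norm_num]
  refine su2_areaLawOnBallW_vertex_of_row (βW := 1 / 10) (by norm_num) (by norm_num) (Real.log_pos (by norm_num)) (by norm_num) hmv ?_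
  exact rhoFR_two_lt_one_of_bounds (by norm_num) (by norm_num) exp_log_six_fifths_div_three_le
    (exp_le_taylor4 (x := 109 / 125) (by norm_num) (by norm_num)) sqrt_two_le (by norm_num) (by norm_num)

/-- Tier-2 frontier cell `(β_W, κ, ε) = (1/8, log 6/5, 0.395)` [door optimum `.3960`]:
`AreaLawOnBallW 2 4 (1 / 16) (log(6/5)) (79 / 100) (79 / 200) mv`. [folklore] -/
theorem su2_frontierW_1_8 {mv : ℕ} (hmv : 1 ≤ mv) :
    AreaLawOnBallW 2 4 (1 / 16) (Real.log (6 / 5)) (79 / 100) (79 / 200) mv := by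
  rw [show (1 / 16 : ℝ) = 1 / 8 / 2 by norm_num]
  refine su2_areaLawOnBallW_vertex_of_row (βW := 1 / 8) (by norm_num) (by norm_num) (Real.log_pos (by norm_num)) (by norm_num) hmv ?_
  exact rhoFR_two_lt_one_of_bounds (by norm_num) (by norm_num) exp_log_six_fifths_div_three_le
    (exp_le_taylor4 (x := 79 / 100) (by norm_num) (by norm_num)) sqrt_two_le (by norm_num) (by norm_num)

/-- Tier-2 frontier cell `(β_W, κ, ε) = (1/6, log 6/5, 0.331)` [door optimum `.3318`]:
`AreaLawOnBallW 2 4 (1 / 12) (log(6/5)) (331 / 500) (331 / 1000) mv`. [folklore] -/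
theorem su2_frontierW_1_6 {mv : ℕ} (hmv : 1 ≤ mv) :
    AreaLawOnBallW 2 4 (1 / 12) (Real.log (6 / 5)) (331 / 500) (331 / 1000) mv := by
  rw [show (1 / 12 : ℝ) = 1 / 6 / 2 by norm_num]
  refine su2_areaLawOnBallW_vertex_of_row (βW := 1 / 6) (by norm_num) (by norm_num) (Real.log_pos (by norm_num)) (by norm_num) hmv ?_
  exact rhoFR_two_lt_one_of_bounds (by norm_num) (by norm_num) exp_log_six_fifths_div_three_le
    (exp_le_taylor4 (x := 331 / 500) (by norm_num) (by norm_num)) sqrt_two_le (by norm_num) (by norm_num)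

/-- Tier-2 frontier cell `(β_W, κ, ε) = (1/5, log 6/5, 0.279)` [door optimum `.2800`]:
`AreaLawOnBallW 2 4 (1 / 10) (log(6/5)) (279 / 500) (279 / 1000) mv`. [folklore] -/
theorem su2_frontierW_1_5 {mv : ℕ} (hmv : 1 ≤ mv) :
    AreaLawOnBallW 2 4 (1 / 10) (Real.log (6 / 5)) (279 / 500) (279 / 1000) mv := by
  rw [show (1 / 10 : ℝ) = 1 / 5 / 2 by norm_num]
  refine su2_areaLawOnBallW_vertex_of_row (βW := 1 / 5) (by norm_num) (by norm_num) (Real.log_pos (by norm_num)) (by norm_num) hmv ?_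
  exact rhoFR_two_lt_one_of_bounds (by norm_num) (by norm_num) exp_log_six_fifths_div_three_le
    (exp_le_taylor4 (x := 279 / 500) (by norm_num) (by norm_num)) sqrt_two_le (by norm_num) (by norm_num)

/-- Tier-2 frontier cell `(β_W, κ, ε) = (1/4, log 6/5, 0.218)` [door optimum `.2190`]:
`AreaLawOnBallW 2 4 (1 / 8) (log(6/5)) (109 / 250) (109 / 500) mv`. [folklore] -/
theorem su2_frontierW_1_4 {mv : ℕ} (hmv : 1 ≤ mv) :
    AreaLawOnBallW 2 4 (1 / 8) (Real.log (6 / 5)) (109 / 250) (109 / 500) mv := by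
  rw [show (1 / 8 : ℝ) = 1 / 4 / 2 by norm_num]
  refine su2_areaLawOnBallW_vertex_of_row (βW := 1 / 4) (by norm_num) (by norm_num) (Real.log_pos (by norm_num)) (by norm_num) hmv ?_
  exact rhoFR_two_lt_one_of_bounds (by norm_num) (by norm_num) exp_log_six_fifths_div_three_le
    (exp_le_taylor4 (x := 109 / 250) (by norm_num) (by norm_num)) sqrt_two_le (by norm_num) (by norm_num)

/-- Tier-2 frontier cell `(β_W, κ, ε) = (3/10, log 6/5, 0.171)` [door optimum `.1713`]:
`AreaLawOnBallW 2 4 (3 / 20) (log(6/5)) (171 / 500) (171 / 1000) mv`. [folklore] -/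
theorem su2_frontierW_3_10 {mv : ℕ} (hmv : 1 ≤ mv) :
    AreaLawOnBallW 2 4 (3 / 20) (Real.log (6 / 5)) (171 / 500) (171 / 1000) mv := by
  rw [show (3 / 20 : ℝ) = 3 / 10 / 2 by norm_num]
  refine su2_areaLawOnBallW_vertex_of_row (βW := 3 / 10) (by norm_num) (by norm_num) (Real.log_pos (by norm_num)) (by norm_num) hmv ?_
  exact rhoFR_two_lt_one_of_bounds (by norm_num) (by norm_num) exp_log_six_fifths_div_three_le
    (exp_le_taylor4 (x := 171 / 500) (by norm_num) (by norm_num)) sqrt_two_le (by norm_num) (by norm_num)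

/-- Tier-2 frontier cell `(β_W, κ, ε) = (1/3, log 6/5, 0.144)` [door optimum `.1447`]:
`AreaLawOnBallW 2 4 (1 / 6) (log(6/5)) (36 / 125) (18 / 125) mv`. [folklore] -/
theorem su2_frontierW_1_3 {mv : ℕ} (hmv : 1 ≤ mv) :
    AreaLawOnBallW 2 4 (1 / 6) (Real.log (6 / 5)) (36 / 125) (18 / 125) mv := by
  rw [show (1 / 6 : ℝ) = 1 / 3 / 2 by norm_num]
  refine su2_areaLawOnBallW_vertex_of_row (βW := 1 / 3) (by norm_num) (by norm_num) (Real.log_pos (by norm_num)) (by norm_num) hmv ?_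
  exact rhoFR_two_lt_one_of_bounds (by norm_num) (by norm_num) exp_log_six_fifths_div_three_le
    (exp_le_taylor4 (x := 36 / 125) (by norm_num) (by norm_num)) sqrt_two_le (by norm_num) (by norm_num)

/-- Tier-2 frontier cell `(β_W, κ, ε) = (2/5, log 6/5, 0.100)` [door optimum `.1002`]:
`AreaLawOnBallW 2 4 (1 / 5) (log(6/5)) (1 / 5) (1 / 10) mv`. [folklore] -/
theorem su2_frontierW_2_5 {mv : ℕ} (hmv : 1 ≤ mv) :
    AreaLawOnBallW 2 4 (1 / 5) (Real.log (6 / 5)) (1 / 5) (1 / 10) mv := by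
  -- here `β = ε₀ = 1/5`, so the coupling is rewritten through the `(3+1)`-form lemma and `norm_num` instead of `rw`
  have h := su2_areaLawOnBallW_vertex_of_row (βW := 2 / 5) (ε₀ := 1 / 5) (ε₁ := 1 / 10) (by norm_num) (by norm_num)
    (Real.log_pos (by norm_num)) (by norm_num) hmv
    (rhoFR_two_lt_one_of_bounds (by norm_num) (by norm_num) exp_log_six_fifths_div_three_le
      (exp_le_taylor4 (x := 1 / 5) (by norm_num) (by norm_num)) sqrt_two_le (by norm_num) (by norm_num))
  norm_num at h
  exact h

/-- Tier-2 frontier cell `(β_W, κ, ε) = (9/20, log 6/5, 0.072)` [door optimum `.0727`]: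
`AreaLawOnBallW 2 4 (9 / 40) (log(6/5)) (18 / 125) (9 / 125) mv`. [folklore] -/
theorem su2_frontierW_9_20 {mv : ℕ} (hmv : 1 ≤ mv) :
    AreaLawOnBallW 2 4 (9 / 40) (Real.log (6 / 5)) (18 / 125) (9 / 125) mv := by
  rw [show (9 / 40 : ℝ) = 9 / 20 / 2 by norm_num]
  refine su2_areaLawOnBallW_vertex_of_row (βW := 9 / 20) (by norm_num) (by norm_num) (Real.log_pos (by norm_num)) (by norm_num) hmv ?_
  exact rhoFR_two_lt_one_of_bounds (by norm_num) (by norm_num) exp_log_six_fifths_div_three_le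
    (exp_le_taylor4 (x := 18 / 125) (by norm_num) (by norm_num)) sqrt_two_le (by norm_num) (by norm_num)

/-- Tier-2 frontier cell `(β_W, κ, ε) = (1/2, log 6/5, 0.048)` [door optimum `.0488`]:
`AreaLawOnBallW 2 4 (1 / 4) (log(6/5)) (12 / 125) (6 / 125) mv`. [folklore] -/
theorem su2_frontierW_1_2 {mv : ℕ} (hmv : 1 ≤ mv) :
    AreaLawOnBallW 2 4 (1 / 4) (Real.log (6 / 5)) (12 / 125) (6 / 125) mv := by
  rw [show (1 / 4 : ℝ) = 1 / 2 / 2 by norm_num]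
  refine su2_areaLawOnBallW_vertex_of_row (βW := 1 / 2) (by norm_num) (by norm_num) (Real.log_pos (by norm_num)) (by norm_num) hmv ?_
  exact rhoFR_two_lt_one_of_bounds (by norm_num) (by norm_num) exp_log_six_fifths_div_three_le
    (exp_le_taylor4 (x := 12 / 125) (by norm_num) (by norm_num)) sqrt_two_le (by norm_num) (by norm_num)

/-- Tier-2 frontier cell `(β_W, κ, ε) = (11/20, log 6/5, 0.027)` [door optimum `.0279`]:
`AreaLawOnBallW 2 4 (11 / 40) (log(6/5)) (27 / 500) (27 / 1000) mv`. [folklore] -/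
theorem su2_frontierW_11_20 {mv : ℕ} (hmv : 1 ≤ mv) :
    AreaLawOnBallW 2 4 (11 / 40) (Real.log (6 / 5)) (27 / 500) (27 / 1000) mv := by
  rw [show (11 / 40 : ℝ) = 11 / 20 / 2 by norm_num]
  refine su2_areaLawOnBallW_vertex_of_row (βW := 11 / 20) (by norm_num) (by norm_num) (Real.log_pos (by norm_num)) (by norm_num) hmv ?_
  exact rhoFR_two_lt_one_of_bounds (by norm_num) (by norm_num) exp_log_six_fifths_div_three_le
    (exp_le_taylor4 (x := 27 / 500) (by norm_num) (by norm_num)) sqrt_two_le (by norm_num) (by norm_num)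

/-- Tier-2 frontier cell `(β_W, κ, ε) = (3/5, log 6/5, 0.009)` [door optimum `.0093`]:
`AreaLawOnBallW 2 4 (3 / 10) (log(6/5)) (9 / 500) (9 / 1000) mv`. [folklore] -/
theorem su2_frontierW_3_5 {mv : ℕ} (hmv : 1 ≤ mv) :
    AreaLawOnBallW 2 4 (3 / 10) (Real.log (6 / 5)) (9 / 500) (9 / 1000) mv := by
  rw [show (3 / 10 : ℝ) = 3 / 5 / 2 by norm_num]
  refine su2_areaLawOnBallW_vertex_of_row (βW := 3 / 5) (by norm_num) (by norm_num) (Real.log_pos (by norm_num)) (by norm_num) hmv ?_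
  exact rhoFR_two_lt_one_of_bounds (by norm_num) (by norm_num) exp_log_six_fifths_div_three_le
    (exp_le_taylor4 (x := 9 / 500) (by norm_num) (by norm_num)) sqrt_two_le (by norm_num) (by norm_num)

/-- The tier-2 frontier table as one conjunction (for citation). [folklore] -/
theorem su2_frontierW_table {mv : ℕ} (hmv : 1 ≤ mv) :
    AreaLawOnBallW 2 4 (1 / 20) (Real.log (6 / 5)) (109 / 125) (109 / 250) mv ∧
    AreaLawOnBallW 2 4 (1 / 16) (Real.log (6 / 5)) (79 / 100) (79 / 200) mv ∧
    AreaLawOnBallW 2 4 (1 / 12) (Real.log (6 / 5)) (331 / 500) (331 / 1000) mv ∧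
    AreaLawOnBallW 2 4 (1 / 10) (Real.log (6 / 5)) (279 / 500) (279 / 1000) mv ∧
    AreaLawOnBallW 2 4 (1 / 8) (Real.log (6 / 5)) (109 / 250) (109 / 500) mv ∧
    AreaLawOnBallW 2 4 (3 / 20) (Real.log (6 / 5)) (171 / 500) (171 / 1000) mv ∧
    AreaLawOnBallW 2 4 (1 / 6) (Real.log (6 / 5)) (36 / 125) (18 / 125) mv ∧
    AreaLawOnBallW 2 4 (1 / 5) (Real.log (6 / 5)) (1 / 5) (1 / 10) mv ∧
    AreaLawOnBallW 2 4 (9 / 40) (Real.log (6 / 5)) (18 / 125) (9 / 125) mv ∧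
    AreaLawOnBallW 2 4 (1 / 4) (Real.log (6 / 5)) (12 / 125) (6 / 125) mv ∧
    AreaLawOnBallW 2 4 (11 / 40) (Real.log (6 / 5)) (27 / 500) (27 / 1000) mv ∧
    AreaLawOnBallW 2 4 (3 / 10) (Real.log (6 / 5)) (9 / 500) (9 / 1000) mv :=
  ⟨su2_frontierW_1_10 hmv, su2_frontierW_1_8 hmv, su2_frontierW_1_6 hmv, su2_frontierW_1_5 hmv, su2_frontierW_1_4 hmv, su2_frontierW_3_10 hmv, su2_frontierW_1_3 hmv, su2_frontierW_2_5 hmv, su2_frontierW_9_20 hmv, su2_frontierW_1_2 hmv, su2_frontierW_11_20 hmv, su2_frontierW_3_5 hmv⟩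

end Summit.Ventures.YMGap.RobustBall

end
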